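import Summits.BirchSwinnertonDyer.BirchSwinnertonDyer.Theorems.PrintCf2RamifiedOffTYZMoverSumBlocksSixBlocks
import HarnessLib

/-!
# Crux `PrintCf2.RamifiedOffTYZOfFacts` (stmt-BirchSwinnertonDyer-20509), line `offtyz-v7`, LEAD cycle 10 (cruxlead-20509 g9):
# THE EVEN BLOCK SUM — for `n = 2p₁⋯p_k ≡ 6 (mod 8)` the `τ(1)`-coefficient of `(hh)·P(n) − P(n)` for the KUMMER ELEMENT `h`
# (fixing `i`, moving `i√−2` and `i√−pᵢ`, fixing every other `i√−p_j`) IS `adj(M_even)_{(inl i)(inr i)}` (programme F3, assembly)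

THEOREMS ONLY (no `def`, no named fact, no `sorry`), `--supports stmt-BirchSwinnertonDyer-20509` (the `s = 1`, `n ≡ 6 (8)` stratum of item
23432 `RamifiedOffJumpOneOfFacts`; even companion of g7's `…MoverSumBlocks` / g8's `…MoverSumBlocksOdd`).

INPUT (crux workfile `Lines/offtyz_v7_SevenSector.md` §9 (E3)): the even Möbius inversion `galPt_mul_self_P_ne_iff_even` (p703022: the
`τ(1)`-coefficient is `ι(n) + Σ_{d∈R(n)} ℓ(n/d) ι(d) + (chains through blocks ≡ 5)`), the block law on `d ≡ 6 (mod 8)`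
`sqMotion_eq_kerSum_dotProduct_bits_six` (p704973, genus regime `g(d)` odd ∧ `#ker N_d = 2`, conductor-`4` Frobenius clause as hypothesis),
the kernel line in census coordinates `kerSum_six_inl_add_inr` (p707529), the identity **(★)₆** `adjugate_monskyMatrixEven_inl_inr_eq_sum_filter`
(p707948) and TYZ Thm 1.1 for the cofactor parities.
* §1–§3 (previous file `…MoverSumBlocksSixBlocks`): divisor bookkeeping for `n = 2m`, the cofactor parity `|𝓛(n/2d_S)| ≡ coblockWeight p S`,
  and the block motions of the Kummer element (odd blocks: `0`; even blocks `2d_S ∋ pᵢ` in the genus regime: the Cramer determinant of (★)₆).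
* §4 (this file) **`sqMover_six_of_adjugate_eq_one`**: if `adj(M_even)_{(inl i)(inr i)} = 1` and every even block `2d_S ∋ pᵢ` with `coblockWeight p S = 1`
  is in the genus regime, then `(hh)·P(n) ≠ P(n)`.
All hypotheses are printed sentences (TYZ §3.1 / Prop. 3.2 / Thm. 3.6 displays, the conductor-`4` Frobenius clause — Prop. 3.2 (2) with Cox
Lemma 5.19 / §9.A, NOT yet typed as a named fact and therefore an explicit hypothesis — and Thm 1.1). BSD is not proved by any of this; no class is
closed by this file.

References: [cite: TianYuanZhang2017, Thm. 1.1, §3.1 (p0011 L1–L73), Prop. 3.2 (2), Thm. 3.5, Thm. 3.6 (2), proof of Lemma 3.21 (p0020 L27–L63)];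
[cite: HeathBrown1994SelmerCongruentII, Appendix (Monsky), typescript p. 39 L10 – p. 41 L36]; [cite: Smith2016CongruentDensity, Thm. 1.2];
[cite: Cox2013, §5.C Lemma 5.19, (5.22), §9.A]; crux notes `Lines/offtyz_v7_SevenSector.md` §8–§10.
-/

noncomputable section

open scoped Classical NumberField

open WeierstrassCurve WeierstrassCurve.Affine Finset Matrix Literature.NumberTheory.EllipticCurves
  Literature.NumberTheory.EllipticCurves.TianYuanZhang2017
  Literature.NumberTheory.EllipticCurves.TianYuanZhang2017.W2
  Literature.NumberTheory.EllipticCurves.HeathBrown1994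
  Literature.NumberTheory.EllipticCurves.HeathBrown1994.Families
  Literature.NumberTheory.EllipticCurves.Smith2016
  Literature.NumberTheory.EllipticCurves.MonskySelmerParity
  Literature.NumberTheory.QuadraticFields.RingClass
  Literature.NumberTheory.QuadraticFields
  Literature.LinearAlgebra.Matrix
  Summit.BirchSwinnertonDyer.Rank1Residual.P2.GenusPeriodTransferLayer
  Summit.BirchSwinnertonDyer.Rank1Residual.P2.ThetaDescent
  Summit.BirchSwinnertonDyer.PrintCf2.QForm
  Summit.BirchSwinnertonDyer.PrintCf2.QFormForest

set_option autoImplicit false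

namespace Summit.BirchSwinnertonDyer.PrintCf2.MoverAssembly

variable {k : ℕ} (p : Fin k → ℕ) (hp : ∀ i, (p i).Prime) (hodd : ∀ i, Odd (p i)) (hinj : Function.Injective p)
variable {n : ℕ} (D : GenusPointData n)

/-! ## §4 The even block sum of the Kummer element is `adj(M_even)_{(inl i)(inr i)}` -/

include hp hodd hinj in
/-- **The block motion of the Kummer element VANISHES ON EVERY ODD BLOCK** `d ∣ n` (as the `𝔽₂`-valued indicator of
`(d ≡ 5, 6) ∧ h(√−d) = √−d ∧ (hh)^{g(d)}σ_d⁻¹ ∈ Gal(ℍ′_n/H′_d)`): an odd block with the indicator on is `≡ 5 (mod 8)`, is fixed by `h` only if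
`pᵢ ∤ d`, and then `h` is trivial on `L_d(i)`. [cite: TianYuanZhang2017, proof of Lemma 3.21 (p0020 L55–L62)] -/
theorem kummer_blockMotion_eq_zero_of_odd (hn : n = 2 * ∏ i, p i)
    (z : ℕ → APoint D.H) (Φ : ℕ → Finset (D.H ≃ₐ[ℚ] D.H)) (ΓH ΓH' : ℕ → Subgroup (D.H ≃ₐ[ℚ] D.H))
    (σ : ℕ → (D.H ≃ₐ[ℚ] D.H)) (c : D.H ≃ₐ[ℚ] D.H)
    (hblock : ∀ d ∈ n.divisors, ((d % 8 = 5 ∨ d % 8 = 6) → D.CMBlockSpec d (z d) (Φ d) (ΓH d) (ΓH' d) (σ d) c) ∧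
      (d % 8 = 7 → D.SevenBlockSpec d))
    {h : D.H ≃ₐ[ℚ] D.H} (hhi : h D.im = D.im) {i : Fin k}
    (hhp : ∀ j, h (D.im * D.sqrtNeg (p j)) = D.im * D.sqrtNeg (p j) ↔ j ≠ i) {d : ℕ} (hd : d ∈ n.divisors) (hdodd : Odd d) :
    (if (d % 8 = 5 ∨ d % 8 = 6) ∧ h (D.sqrtNeg d) = D.sqrtNeg d ∧ (h * h) ^ gK d * (σ d)⁻¹ ∈ ΓH' d then (1 : ZMod 2) else 0) = 0 := by
  rw [if_neg]
  rintro ⟨h56, hfix, hmem⟩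
  have hd5 : d % 8 = 5 := by
    rcases h56 with h5 | h6
    · exact h5
    · exfalso; rcases hdodd with ⟨r, hr⟩; omega
  -- `d = d_{S'}` for `S' = {j : p_j ∣ d}`
  have hm0 : (∏ i, p i) ≠ 0 := Finset.prod_ne_zero_iff.mpr fun i _ => (hp i).ne_zero
  have hdm : d ∣ ∏ j ∈ (univ : Finset (Fin k)), p j := by
    have hdn : d ∣ 2 * ∏ i, p i := by rw [← hn]; exact Nat.dvd_of_mem_divisors hd
    exact Nat.Coprime.dvd_of_dvd_mul_left
      (Nat.Coprime.symm ((Nat.Prime.coprime_iff_not_dvd Nat.prime_two).mpr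
        (fun h2 => Nat.not_even_iff_odd.mpr hdodd (even_iff_two_dvd.mpr h2)))) hdn
  set S' := (univ : Finset (Fin k)).filter (fun j => p j ∣ d) with hS'
  have hdS : d = ∏ j ∈ S', p j := eq_blockProd_filter_of_dvd p hp hinj univ hdm
  have hd1 : 1 < d := by omega
  rw [hdS] at hfix hmem hd1
  have hiS : i ∉ S' := (kummer_apply_sqrtNeg_odd_iff p hp D hn hhi hhp S').mp hfix
  have hCM := (hblock d hd).1 (Or.inl hd5)
  rw [hdS] at hCM
  exact kummer_chi_eq_zero_odd p hp hodd hinj D hn hhi hhp S' hiS hd1 hCM hmem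

include hp hodd in
/-- For `d_S ≡ 3 (mod 4)` inside `m = p₁⋯p_k ≡ 3 (mod 4)` the cofactor `d_{Sᶜ}` is `≡ 1 (mod 4)`, so `≡ 1` or `≡ 5 (mod 8)`.
[cite: TianYuanZhang2017, §3.1 (p0011 L67–L70)] -/
theorem cofactor_mod_eight_of_three (h3 : (∏ i, p i) % 4 = 3) (S : Finset (Fin k)) (hS : (∏ j ∈ S, p j) % 4 = 3) :
    (∏ j ∈ Sᶜ, p j) % 8 = 1 ∨ (∏ j ∈ Sᶜ, p j) % 8 = 5 := by
  have hsplit : (∏ j ∈ S, p j) * (∏ j ∈ Sᶜ, p j) = ∏ i, p i := Finset.prod_mul_prod_compl S p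
  have hmod := Nat.mul_mod (∏ j ∈ S, p j) (∏ j ∈ Sᶜ, p j) 4
  rw [hsplit, h3, hS] at hmod
  have hodd' : Odd (∏ j ∈ Sᶜ, p j) := by
    rw [← prod_blockPrimes]
    exact odd_prod _ (blockPrimes_prime p hp Sᶜ) (ne_two_of_odd _ (blockPrimes_odd p hodd Sᶜ))
  rcases hodd' with ⟨r, hr⟩
  omega

include hp hodd in
/-- `Σ_S (−1/p_j)₊ = 1 ⟺ d_S ≡ 3 (mod 4)` and `= 0 ⟺ d_S ≡ 1 (mod 4)` (the block's sign). [cite: HeathBrown1994SelmerCongruentII, Appendix (Monsky), typescript p. 39 L36–L37] -/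
theorem blockProd_mod_four_of_sum (S : Finset (Fin k)) :
    ((∑ j ∈ S, addLegendreSym (-1) (p j)) = 1 → (∏ j ∈ S, p j) % 4 = 3) ∧
      ((∑ j ∈ S, addLegendreSym (-1) (p j)) = 0 → (∏ j ∈ S, p j) % 4 = 1) := by
  have h := sum_addLegendreSym_neg_one_eq (blockPrimes p S) (blockPrimes_prime p hp S) (ne_two_of_odd _ (blockPrimes_odd p hodd S))
  have hsub : (∑ t, addLegendreSym (-1) (blockPrimes p S t)) = ∑ j ∈ S, addLegendreSym (-1) (p j) := by
    simp only [blockPrimes_apply]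
    rw [← sum_coe_sort S]
    exact (S.orderIsoOfFin rfl).toEquiv.sum_comp (fun x : {x // x ∈ S} => addLegendreSym (-1) (p (x : Fin k)))
  rw [hsub, prod_blockPrimes] at h
  have hoddS : Odd (∏ j ∈ S, p j) := by
    rw [← prod_blockPrimes]; exact odd_prod _ (blockPrimes_prime p hp S) (ne_two_of_odd _ (blockPrimes_odd p hodd S))
  have h13 : (∏ j ∈ S, p j) % 4 = 1 ∨ (∏ j ∈ S, p j) % 4 = 3 := Nat.odd_mod_four_iff.mp (Nat.odd_iff.mp hoddS)
  constructor
  · intro h1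
    rcases h13 with h' | h'
    · rw [h', if_pos rfl] at h; rw [h] at h1; exact absurd h1 zero_ne_one
    · exact h'
  · intro h0
    rcases h13 with h' | h'
    · exact h'
    · rw [if_neg (by omega)] at h; rw [h] at h0; exact absurd h0 one_ne_zero

include hp hodd hinj in
/-- **THE EVEN BLOCK SUM.**  `n = 2p₁⋯p_k ≡ 6 (mod 8)` (`p₁⋯p_k ≡ 3 (mod 4)`), displayed CM-point layer on every block, the lift `θ_d` of `σ_{1+ϖ}` and
the conductor-`4` Frobenius clause on every block `d ≡ 6 (mod 8)`, TYZ Thm 1.1; `h` the Kummer element pointed at `pᵢ` (fixes `i`, moves `i√−2` and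
`i√−pᵢ`, fixes the other `i√−p_j`); every even block `2d_S ∋ pᵢ` with odd cofactor parity (`coblockWeight p S = 1`) in the genus regime
(`g(2d_S)` odd, `#ker N_{2d_S} = 2`). If `adj(M_even)_{(inl i)(inr i)} = 1` then `(hh)·P(n) ≠ P(n)`: the `τ(1)`-coefficient of
`(hh)·P(n) − P(n)` (p703022) reduces to `ι(n) + Σ_{d∈R(n)} ℓ(n/d) ι(d)` (chains through blocks `≡ 5` carry odd blocks), its odd blocks vanish
(§3), its even blocks `2d_S` are the Cramer determinants weighted by `coblockWeight p S` (§2–§3), and their sum is `adj(M_even)_{(inl i)(inr i)}`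
by (★)₆. [cite: TianYuanZhang2017, Thm. 1.1, §3.1 (p0011 L53–L73), Prop. 3.2 (2), Thm. 3.6 (2), proof of Lemma 3.21 (p0020 L27–L63)]
[cite: HeathBrown1994SelmerCongruentII, Appendix (Monsky), typescript p. 41 L20–L36] [cite: Cox2013, §5.C Lemma 5.19, §9.A] -/
theorem sqMover_six_of_adjugate_eq_one (hn : n = 2 * ∏ i, p i) (h3 : (∏ i, p i) % 4 = 3) (hrec : D.recursion) (hLs : D.scriptLSpec)
    (z : ℕ → APoint D.H) (Φ : ℕ → Finset (D.H ≃ₐ[ℚ] D.H)) (ΓH ΓH' : ℕ → Subgroup (D.H ≃ₐ[ℚ] D.H))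
    (σ θ : ℕ → (D.H ≃ₐ[ℚ] D.H)) (c : D.H ≃ₐ[ℚ] D.H) (hc : D.ConjSpec c)
    (hblock : ∀ d ∈ n.divisors, ((d % 8 = 5 ∨ d % 8 = 6) → D.CMBlockSpec d (z d) (Φ d) (ΓH d) (ΓH' d) (σ d) c) ∧
      (d % 8 = 7 → D.SevenBlockSpec d))
    (htheta : ∀ d ∈ n.divisors, d % 8 = 6 → D.ThetaBlockSpec d (z d) (ΓH d) (ΓH' d) (σ d) (θ d))
    (hFrob : ∀ d ∈ n.divisors, d % 8 = 6 → ∀ q : ℕ, q.Prime → q ∣ d → q ≠ 2 → ∃ φ : D.H ≃ₐ[ℚ] D.H,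
      φ (D.sqrtNeg d) = D.sqrtNeg d ∧ φ * φ ∈ ΓH' d ∧ φ D.im = (jacobiSym (-1) q) • D.im ∧
        ∀ r : ℕ, r.Prime → r ∣ n → r ≠ q → φ (D.sqrtNeg r) = (jacobiSym (-(r : ℤ)) q) • D.sqrtNeg r)
    (h11 : thm11_parity_of_scriptL) (i : Fin k)
    (hgenus : ∀ S : Finset (Fin k), i ∈ S → (∑ j ∈ S, addLegendreSym (-1) (p j)) = 1 → coblockWeight p S = 1 →
      Odd (gK (2 * ∏ j ∈ S, p j)) ∧
        Fintype.card {v : Fin S.card ⊕ Unit → ZMod 2 //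
          (Matrix.fromBlocks (legendreMatrix (blockPrimes p S) + legendreDiagonal (blockPrimes p S) (-2))
            (Matrix.of fun j (_ : Unit) => addLegendreSym 2 (blockPrimes p S j))
            (0 : Matrix Unit (Fin S.card) (ZMod 2)) (0 : Matrix Unit Unit (ZMod 2))) *ᵥ v = 0} = 2)
    {h : D.H ≃ₐ[ℚ] D.H} (hhi : h D.im = D.im) (hh2 : h (D.im * D.sqrtNeg 2) ≠ D.im * D.sqrtNeg 2)
    (hhp : ∀ j, h (D.im * D.sqrtNeg (p j)) = D.im * D.sqrtNeg (p j) ↔ j ≠ i)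
    (hadj : (monskyMatrixEven p).adjugate (Sum.inl i) (Sum.inr i) = 1) :
    D.galPt (h * h) (D.P n) ≠ D.P n := by
  have hp2 : ∀ i, p i ≠ 2 := ne_two_of_odd p hodd
  have hsq : Squarefree n := by
    rw [hn, ← prod_cons_two_eq p]
    exact squarefree_prod_of_injective _ (prime_cons_two p hp) (injective_cons_two p hodd hinj)
  have hn0 : n ≠ 0 := hsq.ne_zero
  have hnn : n ∈ n.divisors := Nat.mem_divisors_self n hn0
  have hmodd : Odd (∏ i, p i) := odd_prod p hp hp2
  have h6 : n % 8 = 6 := by rcases hmodd with ⟨r, hr⟩; omega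
  have ht1 : (∑ j, addLegendreSym (-1) (p j)) = 1 := by rw [sum_addLegendreSym_neg_one_eq p hp hp2, if_neg (by omega)]
  -- the `𝔽₂`-valued block motion and weight
  set ι : ℕ → ZMod 2 := fun d =>
    if (d % 8 = 5 ∨ d % 8 = 6) ∧ h (D.sqrtNeg d) = D.sqrtNeg d ∧ (h * h) ^ gK d * (σ d)⁻¹ ∈ ΓH' d then 1 else 0 with hι
  set ℓ : ℕ → ZMod 2 := fun x => (((D.scriptL x).natAbs : ℕ) : ZMod 2) with hℓ
  -- odd blocks carry no motion
  have hιodd : ∀ d ∈ n.divisors, Odd d → ι d = 0 := fun d hd hdo =>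
    kummer_blockMotion_eq_zero_of_odd p hp hodd hinj D hn z Φ ΓH ΓH' σ c hblock hhi hhp hd hdo
  have hι5 : ∀ d ∈ n.divisors, d % 8 = 5 → ι d = 0 := fun d hd hd5 =>
    hιodd d hd (Nat.odd_iff.mpr (by omega))
  rw [galPt_mul_self_P_ne_iff_even D hsq h6 hrec z Φ ΓH ΓH' σ c hc hblock h, odd_iff_natCast_zmod_two_eq_one]
  push_cast
  -- fold the casts into `ι`, `ℓ`
  have hfold : ∀ d, ((if (d % 8 = 5 ∨ d % 8 = 6) ∧ h (D.sqrtNeg d) = D.sqrtNeg d ∧ (h * h) ^ gK d * (σ d)⁻¹ ∈ ΓH' d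
      then (1 : ZMod 2) else 0)) = ι d := fun d => rfl
  simp only [hfold]
  -- the chains through blocks `≡ 5 (mod 8)` vanish (odd blocks)
  have hdiv_of_rec : ∀ {e d : ℕ}, e ∈ n.divisors → d ∈ recursionIndex e → d ∈ n.divisors := by
    intro e d he hd
    obtain ⟨hde, -, -, -⟩ := mem_recursionIndex_iff.mp hd
    exact Nat.divisors_subset_of_dvd hn0 (Nat.dvd_of_mem_divisors he) hde
  have h3sum : ∑ d ∈ recursionIndex n, ∑ d' ∈ (recursionIndex d).filter (fun d' => d' % 8 = 5),
      ℓ (n / d) * ℓ (d / d') * ι d' = 0 := by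
    refine Finset.sum_eq_zero fun d hd => Finset.sum_eq_zero fun d' hd' => ?_
    obtain ⟨hd'R, hd'5⟩ := mem_filter.mp hd'
    rw [hι5 d' (hdiv_of_rec (hdiv_of_rec hnn hd) hd'R) hd'5, mul_zero]
  have h4sum : ∑ d ∈ (recursionIndex n).filter (fun d => d % 2 = 0), ∑ d' ∈ recursionIndex d,
      ∑ e ∈ (recursionIndex d').filter (fun e => e % 8 = 5), ℓ (n / d) * ℓ (d / d') * ℓ (d' / e) * ι e = 0 := by
    refine Finset.sum_eq_zero fun d hd => Finset.sum_eq_zero fun d' hd' => Finset.sum_eq_zero fun e he => ?_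
    obtain ⟨hdR, -⟩ := mem_filter.mp hd
    obtain ⟨heR, he5⟩ := mem_filter.mp he
    rw [hι5 e (hdiv_of_rec (hdiv_of_rec (hdiv_of_rec hnn hdR) hd') heR) he5, mul_zero]
  rw [h3sum, h4sum, add_zero, add_zero]
  -- the main sum as a sum over all divisors
  set F : ℕ → ZMod 2 := fun d => (if d = n then 1 else if d ∈ recursionIndex n then ℓ (n / d) else 0) * ι d with hF
  have hmain : ι n + ∑ d ∈ recursionIndex n, ℓ (n / d) * ι d = ∑ d ∈ n.divisors, F d := by
    rw [← Finset.add_sum_erase _ _ hnn]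
    congr 1
    · simp only [hF, if_true, one_mul]
    · have hsub : recursionIndex n ⊆ n.divisors.erase n := by
        intro d hd
        refine mem_erase.mpr ⟨(lt_of_mem_recursionIndex hd).ne, (mem_recursionIndex_iff.mp hd).1⟩
      rw [← Finset.sum_subset hsub]
      · refine Finset.sum_congr rfl fun d hd => ?_
        simp only [hF, if_neg (lt_of_mem_recursionIndex hd).ne, if_pos hd]
      · intro d hd hdn
        obtain ⟨hne, -⟩ := mem_erase.mp hd
        simp only [hF, if_neg hne, if_neg hdn, zero_mul]
  rw [hmain, sum_divisors_two_mul p hp hodd hinj hn F]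
  -- odd divisors contribute nothing
  have hoddpart : (∑ S : Finset (Fin k), F (∏ j ∈ S, p j)) = 0 := by
    refine Finset.sum_eq_zero fun S _ => ?_
    have hdS : (∏ j ∈ S, p j) ∈ n.divisors := by
      rw [hn]
      exact Nat.mem_divisors.mpr ⟨Dvd.dvd.mul_left (Finset.prod_dvd_prod_of_subset _ _ _ (subset_univ S)) 2,
        mul_ne_zero two_ne_zero hmodd.pos.ne'⟩
    have hoS : Odd (∏ j ∈ S, p j) := by
      rw [← prod_blockPrimes]; exact odd_prod _ (blockPrimes_prime p hp S) (ne_two_of_odd _ (blockPrimes_odd p hodd S))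
    simp only [hF]
    rw [hιodd _ hdS hoS, mul_zero]
  rw [hoddpart, zero_add]
  -- even divisors: the (★)₆ sum
  rw [adjugate_monskyMatrixEven_inl_inr_eq_sum_filter p hp hp2 hinj ht1 i] at hadj
  rw [← hadj, sum_filter, ← Finset.powerset_univ]
  refine Finset.sum_congr rfl fun S _ => ?_
  have hdS := twice_blockProd_mem_divisors p hp hn S
  by_cases hiS : i ∈ S
  swap
  · -- `i ∉ S`: `h` moves `√−2d_S`
    have hmv : ¬ h (D.sqrtNeg (2 * ∏ j ∈ S, p j)) = D.sqrtNeg (2 * ∏ j ∈ S, p j) :=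
      fun hf => hiS ((kummer_apply_sqrtNeg_even_iff p hp D hn hhi hh2 hhp S).mp hf)
    have hι0 : ι (2 * ∏ j ∈ S, p j) = 0 := by simp only [hι]; rw [if_neg (fun hh => hmv hh.2.1)]
    simp only [hF]
    rw [hι0, mul_zero, if_neg (fun hh => hiS hh.1)]
  by_cases hS : (∑ j ∈ S, addLegendreSym (-1) (p j)) = 1
  swap
  · -- even block sign `d_S ≡ 1 (mod 4)`: `2d_S ≡ 2 (mod 8)` is not a block
    have hS0 : (∑ j ∈ S, addLegendreSym (-1) (p j)) = 0 := by
      have h01 : ∀ u : ZMod 2, u ≠ 1 → u = 0 := by decide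
      exact h01 _ hS
    have h4' := (blockProd_mod_four_of_sum p hp hodd S).2 hS0
    have hι0 : ι (2 * ∏ j ∈ S, p j) = 0 := by
      simp only [hι]; rw [if_neg]; rintro ⟨h56, -, -⟩; omega
    simp only [hF]
    rw [hι0, mul_zero, if_neg (fun hh => hS hh.2)]
  rw [if_pos ⟨hiS, hS⟩]
  have hS4 := (blockProd_mod_four_of_sum p hp hodd S).1 hS
  have hd8 : (2 * ∏ j ∈ S, p j) % 8 = 6 := by omega
  have hfix : h (D.sqrtNeg (2 * ∏ j ∈ S, p j)) = D.sqrtNeg (2 * ∏ j ∈ S, p j) :=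
    (kummer_apply_sqrtNeg_even_iff p hp D hn hhi hh2 hhp S).mpr hiS
  -- the block motion, when the weight is `1`
  have hmotion : coblockWeight p S = 1 → ι (2 * ∏ j ∈ S, p j) =
      ((lap (fun i j => legendreMatrix p i j) S (fun j => addLegendreSym (-1) (p j) + addLegendreSym 2 (p j))).updateCol i
        (fun r => if r ∈ S then addLegendreSym (-1) (p r) else 0)).det := by
    intro hcw
    obtain ⟨hgodd, hcard⟩ := hgenus S hiS hS hcw
    obtain ⟨hθd, -, -, hθ⟩ := htheta _ hdS hd8
    simp only [hι]
    rw [← kummer_chi_eq_cramer_six p hp hodd hinj D hn hhi hh2 hhp S hiS hS ((hblock _ hdS).1 (Or.inr hd8)) hθd hθ hgodd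
      (hFrob _ hdS hd8) hcard]
    by_cases hm : (h * h) ^ gK (2 * ∏ j ∈ S, p j) * (σ (2 * ∏ j ∈ S, p j))⁻¹ ∈ ΓH' (2 * ∏ j ∈ S, p j)
    · rw [if_pos ⟨Or.inr hd8, hfix, hm⟩, if_pos hm]
    · rw [if_neg (fun hh => hm hh.2.2), if_neg hm]
  by_cases hSu : S = univ
  · -- the full block `d = n`
    subst hSu
    have hdn : 2 * ∏ j ∈ (univ : Finset (Fin k)), p j = n := by rw [hn]
    simp only [hF]
    rw [if_pos hdn, one_mul, coblockWeight_univ, mul_one, hmotion (coblockWeight_univ p)]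
  -- a proper even block
  have hdn : 2 * ∏ j ∈ S, p j ≠ n := by
    intro he
    apply hSu
    apply eq_univ_of_blockProd_eq p hp hinj S
    have : 2 * ∏ j ∈ S, p j = 2 * ∏ i, p i := by rw [he, hn]
    omega
  have hquot : n / (2 * ∏ j ∈ S, p j) = ∏ j ∈ Sᶜ, p j := div_twice_blockProd p hp hn S
  simp only [hF]
  rw [if_neg hdn]
  rcases cofactor_mod_eight_of_three p hp hodd h3 S hS4 with hc1 | hc5
  · -- cofactor `≡ 1 (mod 8)`: a block of the recursion, weight `= coblockWeight`
    have hne : Sᶜ.Nonempty := by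
      rw [Finset.nonempty_iff_ne_empty, Ne, Finset.compl_eq_empty_iff]; exact hSu
    have hgt : 1 < ∏ j ∈ Sᶜ, p j := by
      obtain ⟨j, hj⟩ := hne
      rw [← Finset.mul_prod_erase _ _ hj]
      have h1 := (hp j).one_lt
      have h2 := blockProd_pos p hp (Sᶜ.erase j)
      nlinarith
    have hmemR : 2 * ∏ j ∈ S, p j ∈ recursionIndex n := by
      rw [mem_recursionIndex_iff, hquot]
      exact ⟨hdS, Or.inr (Or.inl hd8), Or.inl hc1, hgt⟩
    rw [if_pos hmemR, hℓ]
    dsimp only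
    rw [scriptL_parity_eq_coblockWeight_six p hp hodd hinj D h11 hn hLs S hSu hc1]
    rcases (by decide : ∀ u : ZMod 2, u = 0 ∨ u = 1) (coblockWeight p S) with hw | hw
    · rw [hw, zero_mul, mul_zero]
    · rw [hw, one_mul, mul_one, hmotion hw]
  · -- cofactor `≡ 5 (mod 8)`: not a block of the recursion, and weight `0`
    have hnotR : 2 * ∏ j ∈ S, p j ∉ recursionIndex n := by
      intro hm
      obtain ⟨-, -, h123, -⟩ := mem_recursionIndex_iff.mp hm
      rw [hquot] at h123
      omega
    rw [if_neg hnotR, zero_mul, coblockWeight_eq_zero_of_cofactor_five p hp hodd hinj S hc5, mul_zero]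

end Summit.BirchSwinnertonDyer.PrintCf2.MoverAssembly

end
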